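import Summits.KontsevichZagierPeriods.Zeta5Search.WedgeDictionaryLevelDescentVFullBoundary
import HarnessLib

/-!
# The kernel ratio of `k₅` (support for REC-K)

HONEST FRAMING: "systematic search; no irrationality claim unless certified".

Pochhammer bookkeeping (`pochQ_succ_right`, `pochQ_shift`, `pochQ_pos`) and the hypergeometric ratio of the kernel factor
`k₅(x) = kernel5 b x` of the level-descent decomposition:

  `k₅(x+1)·(2x+N)·∏_{j∈B}(x+N+1−b_j) = k₅(x)·(2x+N+2)·∏_{j∈B}(x+b_j)`   (`x ≥ 1`, `N = b₀ ≥ 0`, `0 ≤ b_j ≤ N` on `B = {3,4,5,6}`),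

in product form (`kernel5_succ`) and with the four slots written out (`kernel5_succ4`).  Used by the WZ proof of REC-K
(`WedgeDictionaryLevelDescentVFullRecKInterior`, `WedgeDictionaryLevelDescentVFullRecK`).  Exact cross-check: pub-zeta5 g9 `e6_recK.py` (R 200/200).
-/

open Finset

namespace Summit.KontsevichZagierPeriods.Zeta5Search.WedgeDictionary

open Summit.KontsevichZagierPeriods.Zeta5Search.DualSeries

/-! ### §1 Pochhammer bookkeeping and the kernel ratio -/

/-- `(z)_{n+1} = (z)_n (z+n)`. -/
theorem pochQ_succ_right (z : ℚ) (n : ℕ) : pochQ z (n + 1) = pochQ z n * (z + n) := by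
  simp [pochQ, prod_range_succ]

/-- `z (z+1)_n = (z)_n (z+n)`. -/
theorem pochQ_shift (z : ℚ) (n : ℕ) : z * pochQ (z + 1) n = pochQ z n * (z + n) := by
  induction n with
  | zero => simp [pochQ]
  | succ n ih =>
    rw [pochQ_succ_right (z + 1) n, pochQ_succ_right z n, ← mul_assoc, ih]
    push_cast
    ring

/-- `(z)_n > 0` for `z > 0`. -/
theorem pochQ_pos {z : ℚ} (hz : 0 < z) (n : ℕ) : 0 < pochQ z n :=
  prod_pos fun t _ => by positivity

/-- One `B`-slot of the kernel ratio: `(x+1)_β (x+N+2−β)_β · x(x+N+1−β) = (x)_β (x+N+1−β)_β · (x+β)(x+N+1)`. -/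
theorem kernel5_slot_succ (x : ℕ) (N β : ℤ) (hβ : 0 ≤ β) :
    pochQ ((x : ℚ) + 1) β.toNat * pochQ ((x : ℚ) + 1 + N + 1 - β) β.toNat * ((x : ℚ) * ((x : ℚ) + N + 1 - β)) =
      pochQ (x : ℚ) β.toNat * pochQ ((x : ℚ) + N + 1 - β) β.toNat * (((x : ℚ) + β) * ((x : ℚ) + N + 1)) := by
  have hc : ((β.toNat : ℕ) : ℚ) = (β : ℚ) := by exact_mod_cast Int.toNat_of_nonneg hβ
  have h1 := pochQ_shift (x : ℚ) β.toNat
  have h2 := pochQ_shift ((x : ℚ) + N + 1 - β) β.toNat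
  rw [hc] at h1 h2
  rw [show (x : ℚ) + N + 1 - β + 1 = (x : ℚ) + 1 + N + 1 - β by ring] at h2
  linear_combination pochQ ((x : ℚ) + 1 + N + 1 - β) β.toNat * ((x : ℚ) + N + 1 - β) * h1 +
    pochQ (x : ℚ) β.toNat * ((x : ℚ) + β) * h2

/-- **Kernel ratio** (product form): `k₅(x+1)·(2x+N)·∏_{j∈B}(x+N+1−b_j) = k₅(x)·(2x+N+2)·∏_{j∈B}(x+b_j)` (`x ≥ 1`, `N ≥ 0`, `0 ≤ b_j`). -/
theorem kernel5_succ (b : ℕ → ℤ) (x : ℕ) (hx : 1 ≤ x) (hN : 0 ≤ b 0) (hB : ∀ j ∈ Icc 3 6, 0 ≤ b j ∧ b j ≤ b 0) :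
    kernel5 b (x + 1) * ((2 * (x : ℚ) + b 0) * ∏ j ∈ Icc 3 6, ((x : ℚ) + b 0 + 1 - b j)) =
      kernel5 b x * ((2 * (x : ℚ) + b 0 + 2) * ∏ j ∈ Icc 3 6, ((x : ℚ) + b j)) := by
  have hx0 : (0 : ℚ) < x := by exact_mod_cast hx
  have hN' : (0 : ℚ) ≤ b 0 := by exact_mod_cast hN
  have hc : (((b 0).toNat : ℕ) : ℚ) = (b 0 : ℚ) := by exact_mod_cast Int.toNat_of_nonneg hN
  have h0 : (x : ℚ) * pochQ ((x : ℚ) + 1) ((b 0).toNat + 1) = pochQ (x : ℚ) ((b 0).toNat + 1) * ((x : ℚ) + b 0 + 1) := by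
    have h := pochQ_shift (x : ℚ) ((b 0).toNat + 1)
    push_cast at h
    rw [hc] at h
    linear_combination h
  have h4 : pochQ ((x : ℚ) + 1) ((b 0).toNat + 1) ^ 4 * (x : ℚ) ^ 4 =
      pochQ (x : ℚ) ((b 0).toNat + 1) ^ 4 * ((x : ℚ) + b 0 + 1) ^ 4 := by
    rw [← mul_pow, ← mul_pow, mul_comm (pochQ ((x : ℚ) + 1) _) (x : ℚ), h0]
  have hsl : (∏ j ∈ Icc 3 6, pochQ ((x : ℚ) + 1) (b j).toNat * pochQ ((x : ℚ) + 1 + b 0 + 1 - b j) (b j).toNat) *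
      ((x : ℚ) ^ 4 * ∏ j ∈ Icc 3 6, ((x : ℚ) + b 0 + 1 - b j)) =
      (∏ j ∈ Icc 3 6, pochQ (x : ℚ) (b j).toNat * pochQ ((x : ℚ) + b 0 + 1 - b j) (b j).toNat) *
        ((∏ j ∈ Icc 3 6, ((x : ℚ) + b j)) * ((x : ℚ) + b 0 + 1) ^ 4) := by
    rw [show (x : ℚ) ^ 4 = ∏ _j ∈ Icc 3 6, (x : ℚ) by rw [prod_const]; rfl,
      show ((x : ℚ) + b 0 + 1) ^ 4 = ∏ _j ∈ Icc 3 6, ((x : ℚ) + b 0 + 1) by rw [prod_const]; rfl,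
      ← prod_mul_distrib, ← prod_mul_distrib, ← prod_mul_distrib, ← prod_mul_distrib]
    refine prod_congr rfl fun j hj => ?_
    have := kernel5_slot_succ x (b 0) (b j) (hB j hj).1
    linear_combination this
  have hP0 : pochQ (x : ℚ) ((b 0).toNat + 1) ≠ 0 := (pochQ_pos hx0 _).ne'
  have hP0' : pochQ ((x : ℚ) + 1) ((b 0).toNat + 1) ≠ 0 := (pochQ_pos (by positivity) _).ne'
  have hx4 : (x : ℚ) ^ 4 ≠ 0 := by positivity
  unfold kernel5
  push_cast
  simp only [div_mul_eq_mul_div]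
  rw [div_eq_div_iff (pow_ne_zero _ hP0') (pow_ne_zero _ hP0)]
  apply mul_right_cancel₀ hx4
  linear_combination (2 * ((x : ℚ) + 1) + b 0) * (2 * (x : ℚ) + b 0) * pochQ (x : ℚ) ((b 0).toNat + 1) ^ 4 * hsl -
    (2 * (x : ℚ) + b 0) * (2 * (x : ℚ) + b 0 + 2) *
      (∏ j ∈ Icc 3 6, pochQ (x : ℚ) (b j).toNat * pochQ ((x : ℚ) + b 0 + 1 - b j) (b j).toNat) *
      (∏ j ∈ Icc 3 6, ((x : ℚ) + b j)) * h4

/-- **Kernel ratio**, the four `B`-slots written out. -/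
theorem kernel5_succ4 (b : ℕ → ℤ) (x : ℕ) (hx : 1 ≤ x) (hN : 0 ≤ b 0) (hB : ∀ j ∈ Icc 3 6, 0 ≤ b j ∧ b j ≤ b 0) :
    kernel5 b (x + 1) * ((2 * (x : ℚ) + b 0) *
        (((x : ℚ) + b 0 + 1 - b 3) * ((x : ℚ) + b 0 + 1 - b 4) * ((x : ℚ) + b 0 + 1 - b 5) * ((x : ℚ) + b 0 + 1 - b 6))) =
      kernel5 b x * ((2 * (x : ℚ) + b 0 + 2) * (((x : ℚ) + b 3) * ((x : ℚ) + b 4) * ((x : ℚ) + b 5) * ((x : ℚ) + b 6))) := by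
  have h := kernel5_succ b x hx hN hB
  rw [Icc_three_six] at h
  simp only [prod_insert, mem_insert, mem_singleton, prod_singleton, Nat.reduceEqDiff, or_self, not_false_eq_true] at h
  linear_combination h

/-- STATEMENT (kernel ratio; PROVED here as `kernel5_succ_holds`). -/
def kernel5_succ_stmt : Prop :=
  ∀ b : ℕ → ℤ, ∀ x : ℕ, 1 ≤ x → 0 ≤ b 0 → (∀ j ∈ Icc 3 6, 0 ≤ b j ∧ b j ≤ b 0) →
    kernel5 b (x + 1) * ((2 * (x : ℚ) + b 0) *
        (((x : ℚ) + b 0 + 1 - b 3) * ((x : ℚ) + b 0 + 1 - b 4) * ((x : ℚ) + b 0 + 1 - b 5) * ((x : ℚ) + b 0 + 1 - b 6))) =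
      kernel5 b x * ((2 * (x : ℚ) + b 0 + 2) * (((x : ℚ) + b 3) * ((x : ℚ) + b 4) * ((x : ℚ) + b 5) * ((x : ℚ) + b 6)))

/-- The kernel ratio holds. -/
theorem kernel5_succ_holds : kernel5_succ_stmt := fun b x hx hN hB => kernel5_succ4 b x hx hN hB

end Summit.KontsevichZagierPeriods.Zeta5Search.WedgeDictionary
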